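import Mathlib
import Summits.NavierStokesRegularity.OSWSelfSimilar.SheetNSLineTorusCascadeSynthesisSeries
import Summits.NavierStokesRegularity.OSWSelfSimilar.SheetNSLineTorusCascadeLinkModes
import Summits.NavierStokesRegularity.OSWSelfSimilar.SheetNSLineTorusCascadeExistence
import HarnessLib

/-!
# Viscous CLM on the torus (`a = 0`, `σ = 2`): SYNTHESIS, part 2 — the series IS a classical solution; GLOBAL CLASSICAL
# SOLUTIONS FROM `ω₀ = −c sin x` FOR EVERY `0 ≤ c < 12ν` (kernel, MODEL)

HONEST FRAMING (cell ns-blowup GROUP B «PROFILE SEARCH», zone Z3, row Z3-U addendum A-F2 of `HOME/profile/z3/CENSUS-Z3.md`;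
human rulings D-0035/D-0074): **1-D MODEL (viscous Constantin–Lax–Majda equation `ω_t = ω·Hω + ν ω_xx` on `𝕋`,
`H = hilbertTransformCircle`); series calculus, kernel-checked; not Euler, not Navier–Stokes; «violates: none — MODEL».**

Sequel of `SheetNSLineTorusCascadeSynthesisSeries` (the series `synthOmega e`, … built on a geometrically bounded sine cascade
and their termwise calculus). Here:

* `hilbert_synthOmega` — `H(ω(t,·))(x) = Σ_k e_k(t⁺) cos kx` (`Literature…hilbertTransformCircle_tsum`, index shift by the
  vanishing mode `0`);
* `synthOmega_mul_hilbert` — **`ω·Hω = −½ Σ_k (Σ_{i+j=k} e_i e_j) sin kx`**: the analytic signal `z = Σ e_k e^{ikx}` has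
  `Re z = Hω`, `Im z = −ω`, `Im z² = 2 Re z · Im z`, and `z²` is the Cauchy product of the series
  (`tsum_mul_tsum_eq_tsum_sum_antidiagonal_of_summable_norm`) — the converse of the sgn-pairing of `SheetNSLineTorusCascadeLinkModes`;
* `synthOmegaT_eq` — **the equation holds**: `ωt = ω·Hω + ν ωxx` pointwise (the cascade (C) term by term);
* `isClassicalSolution_synth` — for every horizon `T`, `(ω, ωt, ωx, ωxx)` is an `IsClassicalSolution ν T` (the solution class of
  `SheetNSLineTorusCascadeLinkModes`), and `synthOmega_zero_eq` — its datum is `−c sin x`;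
* **`isClassicalSolution_of_lt_twelve`, `exists_global_classicalSolution_of_lt_twelve`** — for `0 < ν`, `0 ≤ c < 12ν` the explicit
  cascade `cascadeSolution ν (sineDatum c)` (`SheetNSLineTorusCascadeExistence`) obeys the stationary-pole envelope
  `0 ≤ e_k ≤ 12νk (c/12ν)^k` (`mode_le_stationaryPole`), hence its series is a GLOBAL classical solution from `−c sin x`:
  **ONE object which is a classical solution on `[0, T]` for every `T`** — global classical existence ON THE MODEL, kernel.

With `SheetNSLineTorusCascadeLink.horizon_lt_log_two_div` this makes the A-F2 dichotomy a pair of kernel theorems AT THE PDE LEVEL: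
`c < 12ν` ⇒ a global classical solution exists; `c ≥ 48ν` ⇒ no classical solution survives to `t = log 2/ν` (certified constants
tighten both sides through `horizon_lt_of_cascade_unbounded` / a certificate's envelope). bears_on: LADDER-NS N5 / zone Z3
(row Z3-U, A-F2) → N1 linear core. WHAT THIS IS NOT: not NS; no uniqueness statement for the PDE (uniqueness of the CASCADE is
`SheetNSLineTorusCascadeExistence`); nothing about the threshold value.
-/

noncomputable section

namespace Summit.NavierStokesRegularity.OSWSelfSimilar
namespace SheetNSLineTorusCascade

open Finset Real Set Filter MeasureTheory Complex
open Literature.Analysis.Fourier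
open scoped Topology

variable {ν c A q : ℝ} {e : ℕ → ℝ → ℝ}

section envelope

variable (he : IsSineCascade ν c e) (hA : 0 ≤ A) (hq : 0 ≤ q) (hq1 : q < 1)
  (hb : ∀ k : ℕ, ∀ t : ℝ, 0 ≤ t → |e k t| ≤ A * k * q ^ k)
include he hA hq hq1 hb

/-! ### The Hilbert transform of the series -/

/-- **`H(ω(t,·))(x) = Σ_k e_k(t⁺) cos(kx)`** (termwise, `H sin k· = −cos k·`; the index is shifted by one because
`hilbertTransformCircle_tsum` counts frequencies from `1`). [new here — MODEL] -/
theorem hilbert_synthOmega (t x : ℝ) :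
    hilbertTransformCircle (synthOmega e t) x = ∑' k : ℕ, e k (max t 0) * Real.cos ((k : ℝ) * x) := by
  -- summability of the shifted coefficient weight `(k+1)·|e_{k+1}|`
  have hw : Summable fun k : ℕ => ((k : ℝ) + 1) * (|(-e (k + 1) (max t 0))| + |(0 : ℝ)|) := by
    have h1 : Summable fun k : ℕ => majorant ν A q (k + 1) :=
      (summable_nat_add_iff 1).mpr (summable_majorant ν A hq hq1)
    refine h1.of_nonneg_of_le (fun k => by positivity) fun k => ?_
    rw [abs_neg, abs_zero, add_zero]
    have hb' := abs_clamp_le hb (k + 1) t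
    calc ((k : ℝ) + 1) * |e (k + 1) (max t 0)| ≤ ((k : ℝ) + 1) * (A * (k + 1 : ℕ) * q ^ (k + 1)) := by
          gcongr
      _ ≤ majorant ν A q (k + 1) := by
          unfold majorant
          push_cast
          have hqk : 0 ≤ q ^ (k + 1) := pow_nonneg hq _
          have hC : A ≤ A + A ^ 2 / 12 + |ν| * A := by nlinarith [abs_nonneg ν, sq_nonneg A]
          have hk1 : ((k : ℝ) + 1) * ((k : ℝ) + 1) ≤ ((k : ℝ) + 1) ^ 3 := by
            have : (1 : ℝ) ≤ (k : ℝ) + 1 := by linarith [Nat.cast_nonneg (α := ℝ) k]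
            nlinarith
          calc ((k : ℝ) + 1) * (A * ((k : ℝ) + 1) * q ^ (k + 1)) = A * ((((k : ℝ) + 1) * ((k : ℝ) + 1)) * q ^ (k + 1)) := by
                ring
            _ ≤ (A + A ^ 2 / 12 + |ν| * A) * (((k : ℝ) + 1) ^ 3 * q ^ (k + 1)) := by gcongr
  -- rewrite the slice as the shifted series
  have hsum0 : Summable fun k : ℕ => e k (max t 0) * Real.sin ((k : ℝ) * x) :=
    (summable_majorant ν A hq hq1).of_norm_bounded fun k => by
      rw [Real.norm_eq_abs]; exact abs_omega_term_le ν hA hq hb k t x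
  have hfun : synthOmega e t = fun y => ∑' k : ℕ,
      ((-e (k + 1) (max t 0)) * Real.sin (((k + 1 : ℕ) : ℝ) * y) + 0 * Real.cos (((k + 1 : ℕ) : ℝ) * y)) := by
    funext y
    unfold synthOmega
    have hsy : Summable fun k : ℕ => e k (max t 0) * Real.sin ((k : ℝ) * y) :=
      (summable_majorant ν A hq hq1).of_norm_bounded fun k => by
        rw [Real.norm_eq_abs]; exact abs_omega_term_le ν hA hq hb k t y
    rw [hsy.tsum_eq_zero_add]
    simp only [Nat.cast_zero, zero_mul, Real.sin_zero, mul_zero, zero_add, ← tsum_neg]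
    refine tsum_congr fun k => ?_
    ring
  rw [hfun, hilbertTransformCircle_tsum hw x]
  -- shift back
  have hcos : Summable fun k : ℕ => e k (max t 0) * Real.cos ((k : ℝ) * x) :=
    (summable_majorant ν A hq hq1).of_norm_bounded fun k => by
      rw [Real.norm_eq_abs]; exact abs_cos_term_le ν hA hq hb k t x
  rw [hcos.tsum_eq_zero_add]
  simp only [Nat.cast_zero, zero_mul, Real.cos_zero, he.zero, mul_one, zero_add, neg_neg, zero_mul, add_zero]

/-! ### The product `ω·Hω` -/

/-- **`ω·Hω = −½ Σ_k (Σ_{i+j=k} e_i e_j) sin(kx)`** (at the clamped time): the analytic signal `z = Σ_k e_k e^{ikx}` has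
`Re z = Hω`, `Im z = −ω`, `Im z² = 2 Re z Im z`, and `z²` is the Cauchy product of the series. [new here — MODEL] -/
theorem synthOmega_mul_hilbert (t x : ℝ) :
    synthOmega e t x * hilbertTransformCircle (synthOmega e t) x
      = -(1 / 2) * ∑' k : ℕ, (∑ p ∈ antidiagonal k, e p.1 (max t 0) * e p.2 (max t 0)) * Real.sin ((k : ℝ) * x) := by
  rw [hilbert_synthOmega he hA hq hq1 hb t x]
  unfold synthOmega
  -- the analytic signal
  set a : ℕ → ℂ := fun k => ((e k (max t 0) : ℝ) : ℂ) * Complex.exp ((((k : ℝ) * x : ℝ) : ℂ) * I) with ha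
  have hnorm : ∀ k, ‖a k‖ = |e k (max t 0)| := fun k => by
    simp only [ha, norm_mul, Complex.norm_real, Real.norm_eq_abs, Complex.norm_exp_ofReal_mul_I, mul_one]
  have hsa : Summable fun k => ‖a k‖ := by
    refine (summable_majorant ν A hq hq1).of_nonneg_of_le (fun k => norm_nonneg _) fun k => ?_
    rw [hnorm]
    have h := abs_cos_term_le ν hA hq hb k t 0
    rwa [mul_zero, Real.cos_zero, mul_one] at h
  -- real and imaginary parts of the terms and of the square's terms
  have hre : ∀ k, (a k).re = e k (max t 0) * Real.cos ((k : ℝ) * x) := fun k => by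
    simp only [ha, Complex.exp_ofReal_mul_I_re, Complex.re_ofReal_mul]
  have him : ∀ k, (a k).im = e k (max t 0) * Real.sin ((k : ℝ) * x) := fun k => by
    simp only [ha, Complex.exp_ofReal_mul_I_im, Complex.im_ofReal_mul]
  set d : ℕ → ℝ := fun k => ∑ p ∈ antidiagonal k, e p.1 (max t 0) * e p.2 (max t 0) with hd
  have hsq_term : ∀ k, ∑ p ∈ antidiagonal k, a p.1 * a p.2
      = ((d k : ℝ) : ℂ) * Complex.exp ((((k : ℝ) * x : ℝ) : ℂ) * I) := by
    intro k
    rw [hd]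
    push_cast
    rw [sum_mul]
    refine sum_congr rfl fun p hp => ?_
    have hsum : p.1 + p.2 = k := mem_antidiagonal.mp hp
    simp only [ha]
    rw [mul_mul_mul_comm, ← Complex.exp_add, ← hsum]
    push_cast
    ring_nf
  -- the Cauchy product
  have hprod : (∑' k, a k) * (∑' k, a k) = ∑' k, ((d k : ℝ) : ℂ) * Complex.exp ((((k : ℝ) * x : ℝ) : ℂ) * I) := by
    rw [tsum_mul_tsum_eq_tsum_sum_antidiagonal_of_summable_norm hsa hsa]
    exact tsum_congr hsq_term
  -- summability of the square series (norm = |d k| ≤ A² k³ q^k)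
  have hsd : Summable fun k => ((d k : ℝ) : ℂ) * Complex.exp ((((k : ℝ) * x : ℝ) : ℂ) * I) := by
    refine Summable.of_norm ?_
    have h6 : Summable fun k : ℕ => A ^ 2 * ((k : ℝ) ^ 3 * q ^ k) :=
      (summable_pow_mul_geometric_of_norm_lt_one 3 (show ‖q‖ < 1 by rwa [Real.norm_of_nonneg hq])).mul_left _
    refine h6.of_nonneg_of_le (fun k => norm_nonneg _) fun k => ?_
    rw [norm_mul, Complex.norm_real, Complex.norm_exp_ofReal_mul_I, mul_one, Real.norm_eq_abs]
    have hqk : 0 ≤ q ^ k := pow_nonneg hq k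
    have hk0 : (0 : ℝ) ≤ k := Nat.cast_nonneg k
    have hk3 : (0 : ℝ) ≤ (k : ℝ) ^ 3 := by positivity
    have hdiv : ((k : ℝ) ^ 3 - k) / 6 ≤ (k : ℝ) ^ 3 := by linarith
    calc |d k| ≤ A ^ 2 * q ^ k * (((k : ℝ) ^ 3 - k) / 6) := abs_conv_le hA hq hb k t
      _ ≤ A ^ 2 * q ^ k * (k : ℝ) ^ 3 := mul_le_mul_of_nonneg_left hdiv (by positivity)
      _ = A ^ 2 * ((k : ℝ) ^ 3 * q ^ k) := by ring
  -- take imaginary parts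
  have hsa' : Summable a := hsa.of_norm
  have hIm_z : (∑' k, a k).im = ∑' k, e k (max t 0) * Real.sin ((k : ℝ) * x) := by
    rw [show (∑' k, a k).im = Complex.imCLM (∑' k, a k) from rfl, ContinuousLinearMap.map_tsum _ hsa']
    exact tsum_congr fun k => by rw [Complex.imCLM_apply, him]
  have hRe_z : (∑' k, a k).re = ∑' k, e k (max t 0) * Real.cos ((k : ℝ) * x) := by
    rw [show (∑' k, a k).re = Complex.reCLM (∑' k, a k) from rfl, ContinuousLinearMap.map_tsum _ hsa']
    exact tsum_congr fun k => by rw [Complex.reCLM_apply, hre]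
  have hIm_sq : ((∑' k, a k) * (∑' k, a k)).im = ∑' k, d k * Real.sin ((k : ℝ) * x) := by
    rw [hprod, show (∑' k, ((d k : ℝ) : ℂ) * Complex.exp ((((k : ℝ) * x : ℝ) : ℂ) * I)).im
      = Complex.imCLM (∑' k, ((d k : ℝ) : ℂ) * Complex.exp ((((k : ℝ) * x : ℝ) : ℂ) * I)) from rfl,
      ContinuousLinearMap.map_tsum _ hsd]
    exact tsum_congr fun k => by
      rw [Complex.imCLM_apply]; simp only [Complex.exp_ofReal_mul_I_im, Complex.im_ofReal_mul]
  have hkey : ((∑' k, a k) * (∑' k, a k)).im = 2 * ((∑' k, a k).re * (∑' k, a k).im) := by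
    rw [Complex.mul_im]; ring
  rw [hIm_z, hRe_z, hIm_sq] at hkey
  -- conclude
  have hfin : (∑' k, e k (max t 0) * Real.sin ((k : ℝ) * x)) * (∑' k, e k (max t 0) * Real.cos ((k : ℝ) * x))
      = (1 / 2) * ∑' k, d k * Real.sin ((k : ℝ) * x) := by
    linear_combination (-(1 / 2) : ℝ) * hkey
  rw [neg_mul, hfin]
  ring


/-! ### The equation -/

omit he in
/-- Summability of the convolution sine series `Σ_k d_k sin(kx)`. -/
theorem summable_conv_sin (t x : ℝ) :
    Summable fun k : ℕ => (∑ p ∈ antidiagonal k, e p.1 (max t 0) * e p.2 (max t 0)) * Real.sin ((k : ℝ) * x) := by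
  have h6 : Summable fun k : ℕ => A ^ 2 * ((k : ℝ) ^ 3 * q ^ k) :=
    (summable_pow_mul_geometric_of_norm_lt_one 3 (show ‖q‖ < 1 by rwa [Real.norm_of_nonneg hq])).mul_left _
  refine h6.of_norm_bounded fun k => ?_
  rw [Real.norm_eq_abs, abs_mul]
  have hqk : 0 ≤ q ^ k := pow_nonneg hq k
  have hk0 : (0 : ℝ) ≤ k := Nat.cast_nonneg k
  have hk3 : (0 : ℝ) ≤ (k : ℝ) ^ 3 := by positivity
  have hdiv : ((k : ℝ) ^ 3 - k) / 6 ≤ (k : ℝ) ^ 3 := by linarith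
  have hk1 : (k : ℝ) ≤ (k : ℝ) ^ 3 := by exact_mod_cast Nat.le_self_pow (by norm_num) k
  have hX : (0 : ℝ) ≤ A ^ 2 * q ^ k * (((k : ℝ) ^ 3 - k) / 6) :=
    mul_nonneg (mul_nonneg (sq_nonneg A) hqk) (by linarith)
  calc |∑ p ∈ antidiagonal k, e p.1 (max t 0) * e p.2 (max t 0)| * |Real.sin ((k : ℝ) * x)|
      ≤ A ^ 2 * q ^ k * (((k : ℝ) ^ 3 - k) / 6) * 1 :=
        mul_le_mul (abs_conv_le hA hq hb k t) (Real.abs_sin_le_one _) (abs_nonneg _) hX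
    _ ≤ A ^ 2 * q ^ k * (k : ℝ) ^ 3 := by rw [mul_one]; exact mul_le_mul_of_nonneg_left hdiv (by positivity)
    _ = A ^ 2 * ((k : ℝ) ^ 3 * q ^ k) := by ring

/-- **The equation `ωt = ω·Hω + ν ωxx` holds pointwise** (every real `t`, with the clamped modes; in particular on `t ≥ 0`).
[new here — MODEL] -/
theorem synthOmegaT_eq (t x : ℝ) :
    synthOmegaT ν e t x = synthOmega e t x * hilbertTransformCircle (synthOmega e t) x + ν * synthOmegaXX e t x := by
  rw [synthOmega_mul_hilbert he hA hq hq1 hb t x]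
  unfold synthOmegaT synthOmegaXX synthRhs
  have hs1 := summable_conv_sin hA hq hq1 hb t x
  have hs2 : Summable fun k : ℕ => e k (max t 0) * ((k : ℝ) ^ 2 * Real.sin ((k : ℝ) * x)) :=
    (summable_majorant 0 A hq hq1).of_norm_bounded fun k => by
      rw [Real.norm_eq_abs]; exact abs_omegaXX_term_le 0 hA hq hb k t x
  have hsplit : (fun k : ℕ => (1 / 2 * (∑ p ∈ antidiagonal k, e p.1 (max t 0) * e p.2 (max t 0))
      - ν * (k : ℝ) ^ 2 * e k (max t 0)) * Real.sin ((k : ℝ) * x))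
      = fun k => (1 / 2) * ((∑ p ∈ antidiagonal k, e p.1 (max t 0) * e p.2 (max t 0)) * Real.sin ((k : ℝ) * x))
        - ν * (e k (max t 0) * ((k : ℝ) ^ 2 * Real.sin ((k : ℝ) * x))) := by
    funext k; ring
  rw [hsplit, (hs1.mul_left (1 / 2)).tsum_sub (hs2.mul_left ν), tsum_mul_left, tsum_mul_left]
  ring

/-! ### The classical solution -/

/-- **The series is a classical solution on every horizon.** [new here — MODEL] -/
theorem isClassicalSolution_synth (T : ℝ) :
    IsClassicalSolution ν T (synthOmega e) (synthOmegaT ν e) (synthOmegaX e) (synthOmegaXX e) where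
  periodic t _ := synthOmega_periodic t
  hasDeriv_x t _ x := hasDerivAt_synthOmega_x hA hq hq1 hb t x
  hasDeriv_xx t _ x := hasDerivAt_synthOmegaX_x hA hq hq1 hb t x
  cont_xx t _ := continuous_synthOmegaXX hA hq hq1 hb t
  cont := (continuous_uncurry_synthOmega he hA hq hq1 hb).continuousOn
  hasDeriv_t _ ht x := hasDerivAt_synthOmega_t he hA hq hq1 hb ht.1 x
  cont_t := (continuous_uncurry_synthOmegaT he hA hq hq1 hb).continuousOn
  pde t _ x := synthOmegaT_eq he hA hq hq1 hb t x

omit hA hq hq1 hb in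
/-- **The datum of the series is `−c sin x`.** [new here — MODEL] -/
theorem synthOmega_zero_eq (x : ℝ) : synthOmega e 0 x = -c * Real.sin x := by
  unfold synthOmega
  rw [max_self, tsum_eq_single 1]
  · rw [he.one_init, Nat.cast_one, one_mul, neg_mul]
  · intro k hk
    rcases Nat.lt_or_ge k 2 with h | h
    · interval_cases k
      · rw [he.zero, zero_mul]
      · exact absurd rfl hk
    · rw [he.init_zero k h, zero_mul]

omit he hA hq hq1 hb in
/-- On `t ≥ 0` the series is the plain sine series of the modes: `ω(t,x) = −Σ_k e_k(t) sin(kx)`. -/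
theorem synthOmega_eq_of_nonneg {t : ℝ} (ht : 0 ≤ t) (x : ℝ) :
    synthOmega e t x = -∑' k : ℕ, e k t * Real.sin ((k : ℝ) * x) := by
  unfold synthOmega; rw [max_eq_left ht]

end envelope

/-! ### Global classical solutions for `0 ≤ c < 12ν` -/

/-- The stationary-pole envelope of the explicit sine cascade for `0 ≤ c < 12ν`:
`|c_k(t)| ≤ 12ν · k · (c/12ν)^k` on `t ≥ 0`. -/
theorem abs_cascadeSolution_le (hν : 0 < ν) (hc : 0 ≤ c) (k : ℕ) (t : ℝ) (ht : 0 ≤ t) :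
    |cascadeSolution ν (sineDatum c) k t| ≤ 12 * ν * k * (c / (12 * ν)) ^ k := by
  have he := isSineCascade_cascadeSolution ν c
  rw [abs_of_nonneg (nonneg he hc k t ht)]
  exact mode_le_stationaryPole he hν hc k t ht

/-- **GLOBAL CLASSICAL SOLUTION FOR `0 ≤ c < 12ν`.** The series of the explicit sine cascade `cascadeSolution ν (sineDatum c)` is,
for EVERY horizon `T`, a classical solution of `ω_t = ω·Hω + ν ω_xx` on `[0, T] × ℝ` in the sense of `IsClassicalSolution`.
[new here — MODEL] -/
theorem isClassicalSolution_of_lt_twelve (hν : 0 < ν) (hc : 0 ≤ c) (h12 : c < 12 * ν) (T : ℝ) :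
    IsClassicalSolution ν T (synthOmega (cascadeSolution ν (sineDatum c))) (synthOmegaT ν (cascadeSolution ν (sineDatum c)))
      (synthOmegaX (cascadeSolution ν (sineDatum c))) (synthOmegaXX (cascadeSolution ν (sineDatum c))) :=
  isClassicalSolution_synth (isSineCascade_cascadeSolution ν c) (by positivity : (0 : ℝ) ≤ 12 * ν)
    (div_nonneg hc (by positivity)) ((div_lt_one (by positivity)).mpr h12) (abs_cascadeSolution_le hν hc) T

/-- Its datum is `−c sin x`. -/
theorem synthOmega_cascadeSolution_zero (c : ℝ) (x : ℝ) :
    synthOmega (cascadeSolution ν (sineDatum c)) 0 x = -c * Real.sin x :=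
  synthOmega_zero_eq (isSineCascade_cascadeSolution ν c) x

/-- **Existence, packaged: for `0 < ν` and `0 ≤ c < 12ν` there is ONE quadruple `(ω, ωt, ωx, ωxx)` with `ω(0,·) = −c sin` which
is a classical solution on `[0, T]` for every `T` — a global classical solution of the periodic viscous CLM from the sine datum.**
(Companion of `horizon_lt_log_two_div`: for `c ≥ 48ν` no classical solution reaches `t = log 2/ν`.) [new here — MODEL] -/
theorem exists_global_classicalSolution_of_lt_twelve (hν : 0 < ν) (hc : 0 ≤ c) (h12 : c < 12 * ν) :
    ∃ ω ωt ωx ωxx : ℝ → ℝ → ℝ, (∀ x, ω 0 x = -c * Real.sin x) ∧ ∀ T : ℝ, IsClassicalSolution ν T ω ωt ωx ωxx :=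
  ⟨_, _, _, _, synthOmega_cascadeSolution_zero c, isClassicalSolution_of_lt_twelve hν hc h12⟩

end SheetNSLineTorusCascade
end Summit.NavierStokesRegularity.OSWSelfSimilar
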